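import Summits.QuantumFields.YangMills.Theorems.PoincareLipschitzMinimisingMapCompactnessMinimality
import HarnessLib

/-!
# Crux `BlockLipschitzL` (stmt-QuantumFields-23533) ∕ `HistoryTailL` (stmt-QuantumFields-19936), LINE 25 «CompactnessTransfer»,
# (C)-PROOF KNIT (C-e) «COMPACTNESS OF ENERGY MINIMISING MAPS `Q → S³` MODULO THE HKL SHELL-COMPETITOR SOCKET»

Cell `ym3-torus` (YM ladder rung R3 = continuum SU(2) Yang–Mills on T³ — a RUNG, NOT the Clay problem: not d = 4, not
infinite volume, not a mass gap); WIDTH helper seat `ym-ust-19936-w2` g13, (C)-PROOF lineage project (LEAD ★w1-19936 g10 GO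
13:49:46Z): lit `Literature.Analysis.PDE.MinimisingMapCompactness` by Hardt–Kinderlehrer–Lin.  Helper `--supports
stmt-QuantumFields-23533`; THEOREMS ONLY (0 `def`, 0 `sorry`; ONE decl-local `maxHeartbeats 400000` with its `-- hb:` reason line, README №24 (a)).  Imports: (C-e2) ✓`…Minimality` and through
it (C-e1), (C-a1/a2/a3) (w2), (C-d) D1 (px16 g9), (C-d0) (px14 g6), the (C-e) letters, the lit def file ✓`HarmonicMapMinimisers`.

WHAT THIS FILE DOES.  ★★★ `minimisingMapCompactness_of_hkl`: the lit named fact `MinimisingMapCompactness` — every sequence of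
ball-minimising unit `W^{1,2}` maps `u_j : Q → S³` with energies `≤ Λ` has a subsequence converging in `L²` and IN ENERGY on every
ball `closedBall y ρ ⊆ Q` to a ball-minimising unit map of the same class — FOLLOWS from the HKL shell-competitor socket (C-bc)
(one hypothesis `hHKL`, constant `K`; discharged by w4 g15's (C-bc) file, after which `minimisingMapCompactness_holds` is a
one-line corollary).  Assembly: (C-a3) ✓`exists_subseq_limit_weakGrad` (subsequence, unit limit `U`, weak gradient `G`,
`L²(Q)` convergence, lower semicontinuity) → (C-e1) ✓`tendsto_energy_ball` (energy convergence on balls) → (C-e2)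
✓`ballMinimal_limit` (the limit minimises) → the def's four conjuncts verbatim (`L²` on balls by monotonicity from `L²(Q)`).

HONEST SCOPE.  CONDITIONAL on the (C-bc) socket; (RS) = lit `MinimisingMapSmoothness` untouched; nothing of S1″, S2♭″,
`BlockLipschitzL`, `HistoryTailL` is closed here.  YM₃ on T³ is rung R3, not Clay; YM gap NOT proved.

References: L. Simon, Theorems on Regularity and Singularity of Energy Minimizing Maps (1996) [Simon1996] (§2.9 Lemma 1 with
Remarks (1)–(2)); R. Hardt, D. Kinderlehrer, F.-H. Lin, Comm. Math. Phys. 105 (1986) 547–570 [HardtKinderlehrerLin1986] (§2);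
S. Luckhaus, Partial Hölder continuity for minima of certain energies among maps into a Riemannian manifold, Indiana Univ.
Math. J. 37 (1988) [Luckhaus1988].
-/

set_option autoImplicit false

noncomputable section

open MeasureTheory Set Function Filter Topology Metric TopologicalSpace
open scoped ENNReal BigOperators

namespace Summit.QuantumFields.YangMills.Theorems.PoincareLipschitzMinimisingMapCompactness

open Literature.Analysis.FunctionSpaces (HasWeakFDerivOn)
open Summit.QuantumFields.YangMills.Theorems.PoincareLipschitzSobolevCubeExtraction (exists_subseq_limit_weakGrad)
open Summit.QuantumFields.YangMills.Theorems.PoincareLipschitzMinimisingMapCompactnessEnergy (tendsto_energy_ball dens_nonneg)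
open Summit.QuantumFields.YangMills.Theorems.PoincareLipschitzMinimisingMapCompactnessMinimality (ballMinimal_limit)

-- hb: README HEARTBEAT BUDGET ∕ №24 (a): measured FAIL at 100k ∕ PASS at the 200k default (one long bookkeeping proof,
-- cumulative budget; no single step is expensive); explicit headroom, statement and proof untouched — w2 g13 2026-08-29 15:05Z
set_option maxHeartbeats 400000 in
/-- ★★★ **(C-e) COMPACTNESS OF ENERGY MINIMISING MAPS `Q → S³`, MODULO THE HKL SHELL-COMPETITOR SOCKET.**  If for some `K ≥ 0`
the socket (C-bc) holds — for any two unit finite-energy `W^{1,2}` maps `u, V` on `Q` and concentric `0 < ρ₁ < ρ₂` with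
`closedBall y ρ₂ ⊆ Q` there is a unit finite-energy `W^{1,2}` map `W` with `W = V` on `ball y ρ₁`, `W = u` off `ball y ρ₂` and
shell energy `≤ K·(E(V,shell) + E(u,shell) + (ρ₂−ρ₁)⁻²∫_shell‖V−u‖²)` — then lit `MinimisingMapCompactness` holds.
[cite: Simon1996, §2.9 Lemma 1 with Remarks (1)–(2); HardtKinderlehrerLin1986, §2] -/
theorem minimisingMapCompactness_of_hkl {K : ℝ} (hK : 0 ≤ K)
    (hHKL : ∀ (hQ : IsOpen {x : EuclideanSpace ℝ (Fin 3) | ∀ i : Fin 3, |x i| < 1})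
      (u V : EuclideanSpace ℝ (Fin 3) → EuclideanSpace ℝ (Fin 4))
      (Gu GV : EuclideanSpace ℝ (Fin 3) → (EuclideanSpace ℝ (Fin 3) →L[ℝ] EuclideanSpace ℝ (Fin 4))),
      HasWeakFDerivOn ⟨{x : EuclideanSpace ℝ (Fin 3) | ∀ i : Fin 3, |x i| < 1}, hQ⟩ volume u Gu →
      HasWeakFDerivOn ⟨{x : EuclideanSpace ℝ (Fin 3) | ∀ i : Fin 3, |x i| < 1}, hQ⟩ volume V GV →
      (∀ x : EuclideanSpace ℝ (Fin 3), (∀ i : Fin 3, |x i| < 1) → ‖u x‖ = 1) →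
      (∀ x : EuclideanSpace ℝ (Fin 3), (∀ i : Fin 3, |x i| < 1) → ‖V x‖ = 1) →
      IntegrableOn (fun x => ∑ i : Fin 3, ‖Gu x (EuclideanSpace.single i (1:ℝ))‖ ^ 2)
        {x : EuclideanSpace ℝ (Fin 3) | ∀ i : Fin 3, |x i| < 1} volume →
      IntegrableOn (fun x => ∑ i : Fin 3, ‖GV x (EuclideanSpace.single i (1:ℝ))‖ ^ 2)
        {x : EuclideanSpace ℝ (Fin 3) | ∀ i : Fin 3, |x i| < 1} volume →
      ∀ (y : EuclideanSpace ℝ (Fin 3)) (ρ₁ ρ₂ : ℝ), 0 < ρ₁ → ρ₁ < ρ₂ →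
      closedBall y ρ₂ ⊆ {x : EuclideanSpace ℝ (Fin 3) | ∀ i : Fin 3, |x i| < 1} →
      ∃ (W : EuclideanSpace ℝ (Fin 3) → EuclideanSpace ℝ (Fin 4))
        (GW : EuclideanSpace ℝ (Fin 3) → (EuclideanSpace ℝ (Fin 3) →L[ℝ] EuclideanSpace ℝ (Fin 4))),
        HasWeakFDerivOn ⟨{x : EuclideanSpace ℝ (Fin 3) | ∀ i : Fin 3, |x i| < 1}, hQ⟩ volume W GW ∧
        (∀ x : EuclideanSpace ℝ (Fin 3), (∀ i : Fin 3, |x i| < 1) → ‖W x‖ = 1) ∧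
        IntegrableOn (fun x => ∑ i : Fin 3, ‖GW x (EuclideanSpace.single i (1:ℝ))‖ ^ 2)
          {x : EuclideanSpace ℝ (Fin 3) | ∀ i : Fin 3, |x i| < 1} volume ∧
        (∀ x ∈ ball y ρ₁, W x = V x) ∧ (∀ x, x ∉ ball y ρ₂ → W x = u x) ∧
        ∫ x in ball y ρ₂ \ ball y ρ₁, ∑ i : Fin 3, ‖GW x (EuclideanSpace.single i (1:ℝ))‖ ^ 2 ≤
          K * ((∫ x in ball y ρ₂ \ ball y ρ₁, ∑ i : Fin 3, ‖GV x (EuclideanSpace.single i (1:ℝ))‖ ^ 2) +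
            (∫ x in ball y ρ₂ \ ball y ρ₁, ∑ i : Fin 3, ‖Gu x (EuclideanSpace.single i (1:ℝ))‖ ^ 2) +
            (ρ₂ - ρ₁)⁻¹ ^ 2 * ∫ x in ball y ρ₂ \ ball y ρ₁, ‖V x - u x‖ ^ 2)) :
    Literature.Analysis.PDE.MinimisingMapCompactness := by
  intro hQ Λ u Gs hcls hΛ
  set Q : Set (EuclideanSpace ℝ (Fin 3)) := {x | ∀ i : Fin 3, |x i| < 1} with hQdef
  have hQm : MeasurableSet Q := hQ.measurableSet
  have hu : ∀ j, HasWeakFDerivOn ⟨Q, hQ⟩ volume (u j) (Gs j) := fun j => (hcls j).1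
  have hu1 : ∀ j (x : EuclideanSpace ℝ (Fin 3)), (∀ i : Fin 3, |x i| < 1) → ‖u j x‖ = 1 := fun j => (hcls j).2.1
  have hGi : ∀ j, IntegrableOn (fun x => ∑ i : Fin 3, ‖Gs j x (EuclideanSpace.single i (1:ℝ))‖ ^ 2) Q volume :=
    fun j => (hcls j).2.2.1
  have hmin := fun j => (hcls j).2.2.2
  -- (C-a3): extraction
  obtain ⟨U, G, φ, hφ, hUm, hW, hU1, hGdens, hae, hL2, hweak, hlsc⟩ :=
    exists_subseq_limit_weakGrad hQ u Gs Λ hu hu1 hGi hΛ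
  -- (C-e1): energy convergence on balls along `φ`
  have hE : ∀ (y : EuclideanSpace ℝ (Fin 3)) (ρ : ℝ), 0 < ρ → closedBall y ρ ⊆ Q →
      Tendsto (fun j => ∫ x in ball y ρ, ∑ i : Fin 3, ‖Gs (φ j) x (EuclideanSpace.single i (1:ℝ))‖ ^ 2) atTop
        (𝓝 (∫ x in ball y ρ, ∑ i : Fin 3, ‖G x (EuclideanSpace.single i (1:ℝ))‖ ^ 2)) :=
    fun y ρ hρ hρQ => tendsto_energy_ball hQ hK (hHKL hQ) (u := fun j => u (φ j)) (Gs := fun j => Gs (φ j))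
      (fun j => hu (φ j)) (fun j => hu1 (φ j)) (fun j => hGi (φ j)) (fun j => hmin (φ j)) (fun j => hΛ (φ j))
      hW hU1 hGdens hL2 hlsc hρ hρQ
  refine ⟨U, G, φ, hφ, ⟨hW, fun x _ => hU1 x, hGdens, fun y ρ hρ hρQ W GW hWd hW1 hWi hWU => ?_⟩,
    fun y ρ _ hρQ => ?_, hE⟩
  · -- (C-e2): the limit minimises
    obtain ⟨ρ', hρ', hWU⟩ := hWU
    exact ballMinimal_limit hQ hK (hHKL hQ) (u := fun j => u (φ j)) (Gs := fun j => Gs (φ j))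
      (fun j => hu (φ j)) (fun j => hu1 (φ j)) (fun j => hGi (φ j)) (fun j => hmin (φ j))
      hW hU1 hGdens hL2 hE hρ hρQ hWd hW1 hWi hρ' hWU
  · -- `L²` convergence on balls from `L²(Q)` convergence
    have hballQ : ball y ρ ⊆ Q := ball_subset_closedBall.trans hρQ
    haveI : IsFiniteMeasure (volume.restrict Q) := isFiniteMeasure_restrict.2
      (Summit.QuantumFields.YangMills.Theorems.PoincareLipschitzDyadicMeansWeakLimit.volume_openCube_lt_top).ne
    have hint : ∀ j, IntegrableOn (fun x => ‖u (φ j) x - U x‖ ^ 2) Q volume := fun j => by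
      refine Summit.QuantumFields.YangMills.Theorems.PoincareLipschitzBlowDownWeakGradientLetters.integrable_of_norm_le
        (((hu (φ j)).locallyIntegrableOn.aestronglyMeasurable.sub
          hW.locallyIntegrableOn.aestronglyMeasurable).norm.pow 2) 4 ?_
      filter_upwards [ae_restrict_mem hQm] with x hx
      rw [Real.norm_eq_abs, abs_of_nonneg (sq_nonneg _)]
      have h1 : ‖u (φ j) x - U x‖ ≤ 2 := by
        calc ‖u (φ j) x - U x‖ ≤ ‖u (φ j) x‖ + ‖U x‖ := norm_sub_le _ _
          _ = 2 := by rw [hu1 (φ j) x hx, hU1 x]; norm_num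
      nlinarith [norm_nonneg (u (φ j) x - U x)]
    refine squeeze_zero (fun j => setIntegral_nonneg measurableSet_ball fun x _ => sq_nonneg _)
      (fun j => setIntegral_mono_set (hint j) (Eventually.of_forall fun x => sq_nonneg _) hballQ.eventuallyLE) hL2

end Summit.QuantumFields.YangMills.Theorems.PoincareLipschitzMinimisingMapCompactness

end
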